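import Literature.MathematicalPhysics.QuantumFieldTheory.Balaban1983to89.Node00.BetaOfRecord
import Literature.MathematicalPhysics.QuantumFieldTheory.Balaban1983to89.T4CouplingMatching

/-!
# K1⁹ `StabilityBRunRowsAtRecordR13SepCoPHV` (stmt-QuantumFields-27364), rows conjunct, row (i) — THE CORNER ∕ ZERO-EDGE SEAM AS A KERNEL WITNESS

Cell pub-balaban (b2b), seat `b2b-balaban-beta-an4` (BINDER row D4 OWNER), gen 154; `--kind proof --supports stmt-QuantumFields-27364` (helper; count-neutral).

WHAT.  The β-functions OF RECORD have the constructor shape `β = Node00.betaOfMerged βm β0 γ` with `β0 := Node00.beta0OfMerged βm v₀` — ON the box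
`]0, γ]^{k+1}` β IS the merged β `βm`, OFF it β IS the number `β0 k`, and `β0 k` is the `limUnder (𝓝[>] 0)` of `βm k` along the RAY
`Function.update (v₀ k) (Fin.last k) g`; at the records in play `v₀ k = 0⃗`, i.e. the ray is the ZERO EDGE `(0, …, 0, g)`, which lies OUTSIDE every box for
`k ≥ 1` ([`Node00/BetaOfRecord.lean`] :192∕:198).  Three hypothesis shapes now price row (i) of the deciding crux on the OPEN boxes: node U2's history moduli
`T4CouplingMatching.HistLipschitz` + `FadingMemory`, NE4 `ScaleShiftRate`, and ym-nodeO DEF-1's per-scale corner anchor `BalabanUVNodesK2NamedJetsRemAt.ScaleAnchor β b` (its body — `∀ k δ, 0 < δ → ∃ γ', 0 < γ' ∧ ∀ p ∈ HistBox γ' k, |β_{k+1}(p) − b_k| ≤ δ` — is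
written INLINE below so that this file stays outside the route cone; DEF-1's name applies by unfolding).
THIS FILE is the kernel witness behind CRIT-2's price P2 (pub-ymgap I.30476), DEF-1's reading (i) «anchor ⟹ base-line face is NOT a kernel fact», the b2b-an4 g153
dead-end record and the g154 words [AN4-G154-WORD-1] ∕ [AN4-G154-RCPT-1]: a merged β `βm` (def-free, displayed inside the proof: `βm_{k+1}(v) := v_k` if `v_0 ≠ 0`,
`:= 1` if `v_0 = 0`) such that the record-shape β built from it with `v₀ = 0⃗`
  * satisfies ALL THREE OPEN-BOX LETTERS with the best constants — `HistLipschitz Λ γ β` with `Λ k i = [i = k]`, `FadingMemory 1 θ Λ` for every `0 ≤ θ`,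
    `ScaleShiftRate 0 θ γ β` (NE4 with rate constant ZERO) — and DEF-1's `ScaleAnchor β 0` (every corner value is `0`),
  * yet the split OF RECORD `Node00.oneLoopSplit_betaOfMerged` has one-loop number `β0 1 = 1` at scale 1 (the zero-edge limit) while the diagonal values are
    `β 1 (u, u) = u → 0`: its remainder `β¹_2(u, u) = u − 1` does NOT vanish at the corner, so the last-coupling corner bound (AF-1)
    `|β¹_{k+1}(p)| ≤ C_r·p_k` FAILS for every `C_r`, and every `ScaleAnchor` sequence of β differs from the split's numbers at scale 1.
So: the open-box letters (and the anchor they manufacture, PORT-1's `exists_scaleAnchor_of_histLipschitz`) do NOT identify the diagonal∕corner zero-history values with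
the zero-edge one-loop numbers of the split of record; «corner = edge» ((AF-1)-of-record, CRIT-2 (β3)) is a separate CLOSED-box letter.  Nothing here is about
Bałaban's (1.22): a toy over the tree's constructors, [folklore].

HONEST FRAMING.  A NECESSITY∕SEPARATION witness (count-neutral helper keyed to the deciding crux K1⁹; no stub proved, no node discharged, nothing of Bałaban's analysis
asserted, valued or discharged; (D4) NOT discharged; NOT B12 Thm 2, NOT BetaPertH; route R4 = the conditional finite-𝕋⁴ rung only — NOT continuum, NOT ℝ⁴, NOT OS,
NOT the mass gap, NOT Clay).  No `def`, no `instance`, no `notation`, no `axiom`; imports route-independent (Literature only).  Print context only: [Balaban1987RG1] CMP **109** (1987) (2.12)–(2.14) p. 268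
(«β¹ vanishes at g_k = 0»), (1.20)–(1.22) p. 264, §5 p. 298.
-/

noncomputable section

namespace Summit.QuantumFields.YangMills.Theorems.BalabanUVNodesK1CornerEdgeSeamWitness

open Filter Topology
open scoped BigOperators
open Literature.MathematicalPhysics.QuantumFieldTheory.Balaban1983to89
open Literature.MathematicalPhysics.QuantumFieldTheory.Balaban1983to89.FlowStep (HBeta Box mem_box histBox_eq_box)
open Literature.MathematicalPhysics.QuantumFieldTheory.Balaban1983to89.T4CouplingMatching (HistLipschitz FadingMemory ScaleShiftRate)
open Literature.MathematicalPhysics.QuantumFieldTheory.Balaban1983to89.B12Beta (HistBox)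

/-- **THE WITNESS.**  For every box size `γ > 0` and every rate `0 ≤ θ` there are a merged β `βm` and a reference history `v₀` (namely `βm_{k+1}(v) = v_k` if `v_0 ≠ 0`,
`= 1` if `v_0 = 0`; `v₀ = 0⃗`) such that the record-shape β `β := Node00.betaOfMerged βm (Node00.beta0OfMerged βm v₀) γ` carries node U2's `HistLipschitz` with modulus
`Λ k i = [i = k]` and `FadingMemory 1 θ Λ`, NE4 `ScaleShiftRate 0 θ γ β`, the per-scale corner anchor at `b = 0` (DEF-1's `ScaleAnchor β 0`, body inline), while the split of record has `β0 1 = 1` and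
`β¹_2(u,u) = u − 1` on `]0, γ]`.  [folklore] -/
theorem exists_recordShape_openBoxLetters_corner_ne_edge {γ θ : ℝ} (hγ : 0 < γ) (hθ : 0 ≤ θ) :
    ∃ (βm : HBeta) (v₀ : (k : ℕ) → (Fin (k + 1) → ℝ)),
      HistLipschitz (fun k i => if i = k then 1 else 0) γ (Node00.betaOfMerged βm (Node00.beta0OfMerged βm v₀) γ) ∧
      FadingMemory 1 θ (fun k i => if i = k then 1 else 0) ∧
      ScaleShiftRate 0 θ γ (Node00.betaOfMerged βm (Node00.beta0OfMerged βm v₀) γ) ∧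
      (∀ (k : ℕ) (δ : ℝ), 0 < δ → ∃ γ' : ℝ, 0 < γ' ∧ ∀ p : Fin (k + 1) → ℝ, p ∈ HistBox γ' k →
        |Node00.betaOfMerged βm (Node00.beta0OfMerged βm v₀) γ k p - 0| ≤ δ) ∧
      (Node00.oneLoopSplit_betaOfMerged βm (Node00.beta0OfMerged βm v₀) γ).β0 1 = 1 ∧
      ∀ u : ℝ, 0 < u → u ≤ γ →
        (Node00.oneLoopSplit_betaOfMerged βm (Node00.beta0OfMerged βm v₀) γ).β1 1 (fun _ => u) = u - 1 := by
  classical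
  -- the merged β: the LAST coupling on `{v_0 ≠ 0}` (hence on every box), the number 1 on the hyperplane `{v_0 = 0}` (which carries the zero edge for k ≥ 1);
  -- the reference histories: the zero histories.  (Def-free: opaque locals with their defining equations.)
  obtain ⟨βm, hβm⟩ : ∃ βm : HBeta, βm = fun k v => if v 0 = 0 then 1 else v (Fin.last k) := ⟨_, rfl⟩
  obtain ⟨v₀, hv₀⟩ : ∃ v₀ : (k : ℕ) → (Fin (k + 1) → ℝ), v₀ = fun _ _ => 0 := ⟨_, rfl⟩
  -- ON every box the record-shape β is the last coupling
  have hbox : ∀ (k : ℕ) (p : Fin (k + 1) → ℝ), p ∈ Box γ k →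
      Node00.betaOfMerged βm (Node00.beta0OfMerged βm v₀) γ k p = p (Fin.last k) := by
    intro k p hp
    have hp0 : p 0 ≠ 0 := ne_of_gt (mem_box.mp hp 0).1
    rw [Node00.betaOfMerged_of_mem _ _ _ hp, hβm]
    exact if_neg hp0
  -- the zero-EDGE number at scale 1: along `(0, g)` the merged β is the constant 1
  have hupd : ∀ g : ℝ, Function.update (v₀ 1) (Fin.last 1) g 0 = 0 := fun g => by
    rw [Function.update_of_ne (show (0 : Fin (1 + 1)) ≠ Fin.last 1 by decide), hv₀]
  have hβ0 : Node00.beta0OfMerged βm v₀ 1 = 1 := by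
    unfold Node00.beta0OfMerged
    have hconst : (fun g : ℝ => βm 1 (Function.update (v₀ 1) (Fin.last 1) g)) = fun _ => (1 : ℝ) := by
      funext g
      rw [hβm]
      exact if_pos (hupd g)
    rw [hconst]
    exact tendsto_const_nhds.limUnder_eq
  refine ⟨βm, v₀, ?_, ?_, ?_, ?_, ?_, ?_⟩
  · -- HistLipschitz with Λ k i = [i = k]: only the last coordinate enters, with weight 1
    intro k p q hp hq
    rw [hbox k p hp, hbox k q hq, Finset.sum_eq_single (Fin.last k)]
    · simp
    · intro i _ hi
      have : (i : ℕ) ≠ k := fun h => hi (Fin.ext (by simp [h]))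
      simp [this]
    · intro h; exact absurd (Finset.mem_univ _) h
  · -- FadingMemory 1 θ Λ
    intro k i hik
    by_cases h : i = k
    · subst h; simp
    · refine ⟨by simp [h], ?_⟩
      simp only [h, if_false, one_mul]
      exact pow_nonneg hθ _
  · -- ScaleShiftRate with constant 0: β_{k+2}(w) = w_{k+1} = β_{k+1}(tail w) on the box
    intro k w hw
    have htail : Fin.tail w ∈ Box γ k := mem_box.mpr fun i => mem_box.mp hw i.succ
    rw [hbox (k + 1) w hw, hbox k (Fin.tail w) htail]
    have : Fin.tail w (Fin.last k) = w (Fin.last (k + 1)) := by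
      simp [Fin.tail, Fin.succ_last]
    rw [this, sub_self, abs_zero]
    positivity
  · -- the per-scale anchor at 0 (DEF-1's `ScaleAnchor β 0`): on ]0, min γ δ]^{k+1} the value is the last coupling ≤ δ
    intro k δ hδ
    refine ⟨min γ δ, lt_min hγ hδ, fun p hp => ?_⟩
    have hpγ : p ∈ Box γ k := mem_box.mpr fun i => ⟨(hp i).1, (hp i).2.trans (min_le_left _ _)⟩
    rw [hbox k p hpγ, sub_zero, abs_of_pos (hp _).1]
    exact (hp _).2.trans (min_le_right _ _)
  · -- the split of record's one-loop number at scale 1 is the zero-edge limit 1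
    rw [Node00.oneLoopSplit_betaOfMerged_β0]
    exact hβ0
  · -- the split's remainder on the diagonal at scale 1: β¹ = β − β⁰ = u − 1
    intro u hu huγ
    have hmem : (fun _ : Fin (1 + 1) => u) ∈ Box γ 1 := mem_box.mpr fun _ => ⟨hu, huγ⟩
    have hsplit := (Node00.oneLoopSplit_betaOfMerged βm (Node00.beta0OfMerged βm v₀) γ).split 1 (fun _ => u)
    rw [hbox 1 _ hmem, Node00.oneLoopSplit_betaOfMerged_β0, hβ0] at hsplit
    linarith

/-- **COROLLARY — (AF-1)-OF-RECORD IS NOT IMPLIED BY THE OPEN-BOX LETTERS.**  With all three open-box letters and DEF-1's anchor in force (witness above), the split OF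
RECORD violates the last-coupling corner bound `|β¹_{k+1}(p)| ≤ C_r · p_k` on `]0, γ]^{k+1}` for EVERY constant `C_r` (at scale 1, on the diagonal, where
`β¹_2(u,u) = u − 1`).  [folklore] -/
theorem exists_recordShape_openBoxLetters_not_lastCouplingAF1 {γ θ : ℝ} (hγ : 0 < γ) (hθ : 0 ≤ θ) :
    ∃ (βm : HBeta) (v₀ : (k : ℕ) → (Fin (k + 1) → ℝ)),
      HistLipschitz (fun k i => if i = k then 1 else 0) γ (Node00.betaOfMerged βm (Node00.beta0OfMerged βm v₀) γ) ∧
      FadingMemory 1 θ (fun k i => if i = k then 1 else 0) ∧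
      ScaleShiftRate 0 θ γ (Node00.betaOfMerged βm (Node00.beta0OfMerged βm v₀) γ) ∧
      (∀ (k : ℕ) (δ : ℝ), 0 < δ → ∃ γ' : ℝ, 0 < γ' ∧ ∀ p : Fin (k + 1) → ℝ, p ∈ HistBox γ' k →
        |Node00.betaOfMerged βm (Node00.beta0OfMerged βm v₀) γ k p - 0| ≤ δ) ∧
      ∀ Cr : ℝ, ∃ (k : ℕ) (p : Fin (k + 1) → ℝ), p ∈ Box γ k ∧
        Cr * p (Fin.last k) < |(Node00.oneLoopSplit_betaOfMerged βm (Node00.beta0OfMerged βm v₀) γ).β1 k p| := by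
  obtain ⟨βm, v₀, hL, hF, hS, hA, -, hdiag⟩ := exists_recordShape_openBoxLetters_corner_ne_edge hγ hθ
  refine ⟨βm, v₀, hL, hF, hS, hA, fun Cr => ?_⟩
  -- u := min γ (1 ∕ (2(|Cr| + 1))): then Cr·u ≤ |Cr|·u < 1∕2 ≤ 1 − u = |u − 1|
  set u : ℝ := min γ (1 / (2 * (|Cr| + 1)))
  have hpos : 0 < 1 / (2 * (|Cr| + 1)) := by positivity
  have hu : 0 < u := lt_min hγ hpos
  have huγ : u ≤ γ := min_le_left _ _
  have hu2 : u ≤ 1 / (2 * (|Cr| + 1)) := min_le_right _ _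
  have hule : u ≤ 1 / 2 :=
    hu2.trans (one_div_le_one_div_of_le (by norm_num) (by nlinarith [abs_nonneg Cr]))
  refine ⟨1, fun _ => u, mem_box.mpr fun _ => ⟨hu, huγ⟩, ?_⟩
  rw [hdiag u hu huγ]
  have h1 : |u - 1| = 1 - u := by rw [abs_sub_comm]; exact abs_of_nonneg (by linarith)
  have hCu : Cr * u ≤ |Cr| * u := mul_le_mul_of_nonneg_right (le_abs_self Cr) hu.le
  have hne : |Cr| + 1 ≠ 0 := by positivity
  have hfrac : |Cr| / (|Cr| + 1) < 1 := (div_lt_one (by positivity)).mpr (by linarith)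
  have hkey : |Cr| * u < 1 / 2 := by
    calc |Cr| * u ≤ |Cr| * (1 / (2 * (|Cr| + 1))) := mul_le_mul_of_nonneg_left hu2 (abs_nonneg Cr)
      _ = (|Cr| / (|Cr| + 1)) / 2 := by field_simp
      _ < 1 / 2 := by linarith
  show Cr * u < |u - 1|
  rw [h1]
  linarith

/-- **COROLLARY — NO ANCHOR OF THE RECORD-SHAPE β IS THE SPLIT OF RECORD'S ONE-LOOP SEQUENCE.**  With all three open-box letters in force, the record-shape β HAS a
per-scale corner anchor (`b = 0`; DEF-1's `ScaleAnchor`, body inline; PORT-1's `exists_scaleAnchor_of_histLipschitz` manufactures one from `HistLipschitz` in general), and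
EVERY anchor sequence `b` has `b 1 ≠ β0 1`, the split of record's zero-edge number at scale 1 (anchors are forced to `b 1 = 0` by the diagonal values, while `β0 1 = 1`).  [folklore] -/
theorem exists_recordShape_openBoxLetters_anchor_ne_oneLoopNumber {γ θ : ℝ} (hγ : 0 < γ) (hθ : 0 ≤ θ) :
    ∃ (βm : HBeta) (v₀ : (k : ℕ) → (Fin (k + 1) → ℝ)),
      HistLipschitz (fun k i => if i = k then 1 else 0) γ (Node00.betaOfMerged βm (Node00.beta0OfMerged βm v₀) γ) ∧
      FadingMemory 1 θ (fun k i => if i = k then 1 else 0) ∧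
      ScaleShiftRate 0 θ γ (Node00.betaOfMerged βm (Node00.beta0OfMerged βm v₀) γ) ∧
      (∃ b : ℕ → ℝ, ∀ (k : ℕ) (δ : ℝ), 0 < δ → ∃ γ' : ℝ, 0 < γ' ∧ ∀ p : Fin (k + 1) → ℝ, p ∈ HistBox γ' k →
        |Node00.betaOfMerged βm (Node00.beta0OfMerged βm v₀) γ k p - b k| ≤ δ) ∧
      ∀ b : ℕ → ℝ, (∀ (k : ℕ) (δ : ℝ), 0 < δ → ∃ γ' : ℝ, 0 < γ' ∧ ∀ p : Fin (k + 1) → ℝ, p ∈ HistBox γ' k →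
          |Node00.betaOfMerged βm (Node00.beta0OfMerged βm v₀) γ k p - b k| ≤ δ) →
        b 1 ≠ (Node00.oneLoopSplit_betaOfMerged βm (Node00.beta0OfMerged βm v₀) γ).β0 1 := by
  obtain ⟨βm, v₀, hL, hF, hS, hA, hβ0, hdiag⟩ := exists_recordShape_openBoxLetters_corner_ne_edge hγ hθ
  refine ⟨βm, v₀, hL, hF, hS, ⟨fun _ => 0, hA⟩, fun b hb => ?_⟩
  -- the diagonal values force `b 1 = 0`: at `p = (u, u)` with `u ≤ min γ γ' δ`, `|u − b 1| ≤ δ` and `u ≤ δ`, for every δ > 0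
  have hb1 : b 1 = 0 := by
    by_contra hne
    have hpos : 0 < |b 1| / 3 := by positivity
    obtain ⟨γ', hγ', hγ'b⟩ := hb 1 (|b 1| / 3) hpos
    set u : ℝ := min (min γ γ') (|b 1| / 3)
    have hu : 0 < u := lt_min (lt_min hγ hγ') hpos
    have huγ : u ≤ γ := (min_le_left _ _).trans (min_le_left _ _)
    have huγ' : u ≤ γ' := (min_le_left _ _).trans (min_le_right _ _)
    have huδ : u ≤ |b 1| / 3 := min_le_right _ _
    have hp : (fun _ : Fin (1 + 1) => u) ∈ HistBox γ' 1 := fun _ => ⟨hu, huγ'⟩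
    have h := hγ'b _ hp
    -- β 1 (u,u) = β⁰ 1 + β¹_2(u,u) = 1 + (u − 1) = u
    have hsplit := (Node00.oneLoopSplit_betaOfMerged βm (Node00.beta0OfMerged βm v₀) γ).split 1 (fun _ => u)
    rw [hβ0, hdiag u hu huγ] at hsplit
    rw [hsplit, show (1 : ℝ) + (u - 1) - b 1 = u - b 1 by ring] at h
    have htri : |b 1| ≤ u + |u - b 1| := by
      calc |b 1| = |u - (u - b 1)| := by rw [sub_sub_cancel]
        _ ≤ |u| + |u - b 1| := abs_sub _ _
        _ = u + |u - b 1| := by rw [abs_of_pos hu]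
    have habs : 0 < |b 1| := abs_pos.mpr hne
    linarith
  rw [hb1, hβ0]
  norm_num

end Summit.QuantumFields.YangMills.Theorems.BalabanUVNodesK1CornerEdgeSeamWitness

end
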